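import Literature.AnabelianGeometry.EtaleTheta.Discharge.Sec5Thm57RigidOfKummerComparison

/-!
# [EtTh] §5, Theorem 5.7: the Kummer comparison `HC` ASSEMBLED from the pin (Prop. 5.2 (iii)), Thm. 5.6 and Cor. 2.8 (i) — interface (pp. 328–331 / PDF pp. 102–105)

Mochizuki, *The étale theta function …*, Publ. RIMS **45** (2009)
[cite: MochizukiEtTh2009, Thm 5.7 proof p.330 (PDF p.104); Prop 5.2 (iii) p.324 (PDF p.98); Thm 5.6 p.328 (PDF p.102); Cor 2.8 (i)
p.268 (PDF p.42)].  Seat abc-iut-L2-d4 (gen 5; node `EtTh:Thm5.7`, L2-lead R408 «(C)-junction»).  PROOF-ONLY over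
`Sec5Thm57RigidOfKummerComparison.lean` (p448195).

THE POINT.  p448195 reduced the anabelian residual of Thm. 5.7 at each level to ONE comparison `HC`: `Ψ^Aut_β` maps the bi-Kummer
difference cocycle `h ↦ s^⊓-gp_N(h)·s^⊔-gp_N(h)⁻¹` on `H_{B_N}` to `(diff ∘ θ)·(κ_ξ ∘ θ)`.  Print's sentence (proof of Thm. 5.7,
p.330) «applying the rigidity of the étale theta function [Cor. 2.8 (i)] to the Kummer classes of Prop. 5.2 (iii) … in light of the
crucial isomorphisms of Prop. 5.5, which, by Thm. 5.6, are preserved by `Ψ`» is, in the currency of `Aut_C(B_N)`, the composite of THREE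
statements about a map `ρ : M → Aut_C(B_N)` (Prop. 5.5's rigidity isomorphism `(l·Δ_Θ)_{B_N} ⊗ ℤ/N ⥲ μ_N(B_N)` on its image), a
cocycle `η̃ : H_{B_N} → M` (the mod-`N` étale theta class read on `H_{B_N}`) and a self-map `γ_Δ` of `M` (the transport of
`(l·Δ_Θ) ⊗ ℤ/N` induced by `Ψ^bs`, i.e. by its Galois shadow `γ`):
* (pin)  `s^⊓-gp(h)·s^⊔-gp(h)⁻¹ = ρ(η̃ h)` — Prop. 5.2 (iii) [abc-iut-L2-t4's R-C3 + the (η,ν)-pin F-0521];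
* (K4β)  `Ψ^Aut_β(ρ x) = ρ(γ_Δ x)` — Thm. 5.6 read through the identification `β` [K4, abc-iut-w5-d034/w5-d020];
* (C5Δ)  `ρ(γ_Δ(η̃ h)) = ρ(η̃(θ h))·κ_ξ(θ h)` — Cor. 2.8 (i) at the tower's classes, `θ ↔ γ` by the shadow law, the coboundary absorbed
  into `ξ := (N-th root of ζ)·m` [R-C5, abc-iut-w6-d083].
`ThetaFrobenioid.kummerComparison_of_pin` : (pin) + (K4β) + (C5Δ) ⇒ `HC` (a four-step rewrite); with p448195 and p445072 this is the
complete (C)-chain of Thm. 5.7 modulo those three named inputs.  `M`, `ρ`, `η̃`, `γ_Δ` are ARBITRARY here (no structure assumed) — the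
producers instantiate them.
HONEST FRAMING: a kernel-checked interface identity; none of (pin)/(K4β)/(C5Δ) is proved here; nothing of [EtTh] is asserted
unconditionally; typed ≠ discharged; no side taken on anything downstream ([IUTchIII] Cor. 3.12 in particular). -/

namespace Literature.AnabelianGeometry.EtaleTheta

open CategoryTheory

universe w v v' u u'

namespace ThetaFrobenioid

variable {C : Type u} [Category.{v} C] {D : Type u'} [Category.{v'} D] {𝔉 : ThetaFrobenioid.{w} C D}

/-- **`HC` from (pin), (K4β), (C5Δ)** — see the module docstring.  For any `ρ : M → Aut_C(B_N)`, `η̃ : H_{B_N} → M`, `γ_Δ : M → M`,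
an identification `β : Ψ(B_N) ⥲ B_N`, an automorphism `θ` of `Aut_D(B_N^bs)` with `θ(H_{B_N}) = H_{B_N}` and a unit `ξ`:
if the bi-Kummer difference cocycle is `ρ ∘ η̃` (Prop. 5.2 (iii)), `Ψ^Aut_β ∘ ρ = ρ ∘ γ_Δ` (Thm. 5.6) and
`ρ(γ_Δ(η̃ h)) = ρ(η̃(θh))·κ_ξ(θh)` (Cor. 2.8 (i)), then `Ψ^Aut_β(diff(h)) = diff(θh)·κ_ξ(θh)` for every `h ∈ H_{B_N}` — the hypothesis
`HC` of `isFixed_discrepancy_of_kummerComparison`.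
[cite: MochizukiEtTh2009, Thm 5.7 proof p.330 (PDF p.104); Thm 5.6 p.328 (PDF p.102); Prop 5.2 (iii) p.324 (PDF p.98)] -/
theorem kummerComparison_of_pin {M : Type*} (Ψ : C ≌ C) (β : Ψ.functor.obj 𝔉.BN ≅ 𝔉.BN)
    (θ : Aut (𝔉.base.obj 𝔉.BN) ≃* Aut (𝔉.base.obj 𝔉.BN)) (hYdd : 𝔉.HB.map θ.toMonoidHom = 𝔉.HB) (ξ : Aut 𝔉.BN)
    (ρ : M → Aut 𝔉.BN) (η : 𝔉.HB → M) (γΔ : M → M)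
    (hpin : ∀ h : 𝔉.HB, 𝔉.sgpCap (h : Aut (𝔉.base.obj 𝔉.BN)) * (𝔉.sgpCup h)⁻¹ = ρ (η h))
    (hK4 : ∀ x : M, 𝔉.psiAut Ψ β (ρ x) = ρ (γΔ x))
    (hC5 : ∀ h : 𝔉.HB, ρ (γΔ (η h)) =
      ρ (η ⟨θ h, (mem_iff_of_map_equiv_eq hYdd _).mpr h.2⟩) *
        (𝔉.sgpCup ⟨θ h, (mem_iff_of_map_equiv_eq hYdd _).mpr h.2⟩ * ξ *
          (𝔉.sgpCup ⟨θ h, (mem_iff_of_map_equiv_eq hYdd _).mpr h.2⟩)⁻¹ * ξ⁻¹)) :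
    ∀ h : 𝔉.HB,
      𝔉.psiAut Ψ β (𝔉.sgpCap (h : Aut (𝔉.base.obj 𝔉.BN)) * (𝔉.sgpCup h)⁻¹) =
        (𝔉.sgpCap (θ h) * (𝔉.sgpCup ⟨θ h, (mem_iff_of_map_equiv_eq hYdd _).mpr h.2⟩)⁻¹) *
          (𝔉.sgpCup ⟨θ h, (mem_iff_of_map_equiv_eq hYdd _).mpr h.2⟩ * ξ *
            (𝔉.sgpCup ⟨θ h, (mem_iff_of_map_equiv_eq hYdd _).mpr h.2⟩)⁻¹ * ξ⁻¹) := by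
  intro h
  rw [hpin h, hK4, hC5 h, ← hpin ⟨θ h, (mem_iff_of_map_equiv_eq hYdd _).mpr h.2⟩]
  rfl

end ThetaFrobenioid

end Literature.AnabelianGeometry.EtaleTheta
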